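import Literature.Analysis.FluidPDE.GuillodSverak2023.ProfileCAP
import Literature.Analysis.FluidPDE.GuillodSverak2023.SchauderClosing

/-!
# The typed interface of an `H¹`-Schauder (existence-only) computer-assisted proof of a profile

Cell pub-nsjs (papers/NavierStokesRegularity/ns-jia-sverak), typer gen 14. Third file of the Guillod–Šverák CAP
interface: `ProfileCAP.lean` records the Newton–Kantorovich interface `CAPData` (closing inequality
`4 M K (K ε) ≤ 1`, needs an inverse bound `K`), `SchauderClosing.lean` the real-number algebra of the closing step
of the existence-only `H¹`-Schauder scheme (`SchauderClosingData`: `4 M₃ ε < a²`, radius `x₀`, `selfMap`). The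
cell's LEMMA-D.md §3 and LEMMA-K0.md show that `CAPData` cannot close for the Guillod–Šverák candidate in the
present approximation class (the `L²` inverse bound is `≥ 4` by a theorem, and the energy-lift chain then demands a
defect two decades below the class floor), and that the scheme with a live threshold is the Schauder one. This file
types THAT scheme as an interface `ProfileSchauderData`, in the same spirit as `CAPData`: every field is an
obligation a CAP seat has to discharge, with the constants named, and the conclusion `profileHyp_of_schauderData`
is a kernel-checked modus ponens.

## The scheme (LEMMA-D.md §5, re-derived; in print for a DIFFERENT profile in T. Y. Hou, Y. Wang, C. Yang,
arXiv:2509.25116 (2025), Prop. "Exact self-similar profile", TeX L1814–2058 — a manuscript UNDER ADJUDICATION by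
this cell, hence not cited as a fact; the scheme is folklore Schauder + energy estimates)
Write the profile as `Ū + U` with `Ū` the enclosed finite candidate and `U ∈ H¹_σ` the correction. The linearised
operator is split `𝓛 = 𝓛₁ + 𝓛₂`, `𝓛₁` coercive (`(𝓛₁h,h) ≥ (¼ − η₁)‖h‖² + ‖∇h‖²`, the `¼` being Jia–Šverák 2015's
resolvent edge) and `𝓛₂ = −ℙ Q₋` compact, handled by a finite-rank approximate inverse with tolerances; the
correction is a fixed point `U = T U` of the resulting map, and every fixed point — in fact every image `T u` of a
point `u` of the ball — satisfies the a-priori bound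
  `a ‖T u‖² + b ‖∇(T u)‖² ≤ (ε + M₃ ‖u‖²) ‖T u‖`,   `a = ¼ − η₁ − M₂ > 0`, `b = 1 − M₁ > 0`,
with `ε` the certified defect of `Ū` and `M₁, M₂, M₃` the constants of the finite-rank data (LEMMA-D §5 (W1)–(W4),
node L-E of LEMMAS.md). Under `4 M₃ ε < a²` the set `B := {‖u‖ ≤ x₀, ‖∇u‖² ≤ a x₀²/(4b)}` is mapped into itself
(`SchauderClosingData.selfMap`), and Schauder's theorem (continuity of `T` into `H¹`, compactness of `B` in the
topology in which `T` is continuous — Rellich on balls, then `R → ∞`) gives a fixed point.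

## What is kernel-checked here and what is a hypothesis
* Kernel-checked: the self-map step (`selfMap_ball`), and the assembly `profileHyp_of_schauderData` — a fixed point
  is a zero of the residual, hence (through `ProfileFunctionalSetting.zero_profileHyp`) a classical profile in the
  hypothesis class of JS14 / IJP26 (`ProfileHyp`), within `x₀` of the candidate.
* HYPOTHESIS fields (analytic content, not in Mathlib): `apriori` (the energy estimate with the finite-rank data —
  L-E), `schauder` (the fixed-point principle for `T` on the self-mapped set `B` — Schauder's theorem; `lean search
  'Schauder|Brouwer'` finds no fixed-point theorem of this kind in Mathlib, only Schauder BASES), and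
  `fixed_zero` (a fixed point of `T` is a zero of the setting's residual `F` at `Ū + u`). The regularity and decay of
  the weak `H¹` solution (node CAP-1g of LEMMAS.md; LEMMA-C's bootstrap starts at `H²`) sit inside
  `zero_profileHyp` of the setting, exactly as for `CAPData`.
* The gradient seminorm `grad` is an abstract field (`H¹`-part of the norm); the norm of `X` plays the role of the
  `L²` norm. No number is asserted for the Guillod–Šverák profile: `a, b, ε, M₃` are the unknowns of node CAP-1f.

## References
* J. Guillod, V. Šverák, J. Math. Fluid Mech. 25 (2023), arXiv:1704.00560, L211–219 (profile equation).
  [GuillodSverak2023]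
* H. Jia, V. Šverák, J. Funct. Anal. 268 (2015), Lemma 2.1 (resolvent set `⊇ {Re λ > −¼}`, the origin of the `¼`).
  [JiaSverak2015]
* J. Schauder, Der Fixpunktsatz in Funktionalräumen, Studia Math. 2 (1930) 171–180 (the fixed-point principle
  assumed in the field `schauder`). [Schauder1930]
-/

open Metric

namespace Literature.Analysis.FluidPDE.GuillodSverak2023

open Literature.Analysis.FluidPDE.JiaSverak2014

variable {X Y : Type*} [NormedAddCommGroup X] [NormedSpace ℝ X] [NormedAddCommGroup Y] [NormedSpace ℝ Y]

/-- **Schauder CAP data at a candidate** `a` (the enclosed finite profile `Ū`), for a functional setting `S`: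
a gradient seminorm `grad` on `X`, the fixed-point map `T` of the corrected linearised problem, the closing
constants `C : SchauderClosingData` (`a, b, ε, M₃` with `4 M₃ ε < a²`), the a-priori bound `apriori` on the ball
`‖u‖ ≤ x₀`, the fixed-point principle `schauder` on the self-mapped set, and the identification `fixed_zero` of
fixed points with zeros of the residual at `a + u`. [cite: GuillodSverak2023, L211–219; Schauder1930] -/
structure ProfileSchauderData (S : ProfileFunctionalSetting X Y) where
  /-- The candidate profile `Ū` (the enclosed finite representation). -/
  a : X
  /-- The gradient seminorm (the `H¹` part of the norm; the norm of `X` is the `L²` part). -/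
  grad : X → ℝ
  grad_nonneg : ∀ u, 0 ≤ grad u
  /-- The fixed-point map of the corrected linearised problem (`U ↦ 𝓛₁⁻¹[−E(Ū) − N(U) + finite-rank terms]`). -/
  T : X → X
  /-- The closing constants `a, b, ε, M₃` and the closing condition `4 M₃ ε < a²`. -/
  C : SchauderClosingData
  /-- The a-priori energy bound on the ball of radius `x₀` (LEMMA-D.md §5; node L-E). -/
  apriori : ∀ u : X, ‖u‖ ≤ C.x₀ →
    C.a * ‖T u‖ ^ 2 + C.b * grad (T u) ^ 2 ≤ (C.ε + C.M₃ * ‖u‖ ^ 2) * ‖T u‖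
  /-- Schauder's fixed-point principle for `T` on the self-mapped set `B` (HYPOTHESIS: compactness and continuity
  are the analytic content; not in Mathlib). -/
  schauder : (∀ u : X, ‖u‖ ≤ C.x₀ ∧ C.b * grad u ^ 2 ≤ C.a * C.x₀ ^ 2 / 4 →
      ‖T u‖ ≤ C.x₀ ∧ C.b * grad (T u) ^ 2 ≤ C.a * C.x₀ ^ 2 / 4) →
    ∃ u : X, (‖u‖ ≤ C.x₀ ∧ C.b * grad u ^ 2 ≤ C.a * C.x₀ ^ 2 / 4) ∧ T u = u
  /-- A fixed point of `T` is a zero of the residual at `a + u`. -/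
  fixed_zero : ∀ u : X, T u = u → S.F (a + u) = 0

namespace ProfileSchauderData

variable {S : ProfileFunctionalSetting X Y} (D : ProfileSchauderData S)

/-- The self-mapped set `B = {‖u‖ ≤ x₀, b ‖∇u‖² ≤ a x₀²/4}`. [folklore] -/
def ball (u : X) : Prop := ‖u‖ ≤ D.C.x₀ ∧ D.C.b * D.grad u ^ 2 ≤ D.C.a * D.C.x₀ ^ 2 / 4

/-- **The self-map step**: `T` maps `B` into `B` (kernel-checked from `SchauderClosingData.selfMap` and the
a-priori bound). [folklore] (LEMMA-D.md §5) -/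
theorem selfMap_ball (u : X) (hu : D.ball u) : D.ball (D.T u) := by
  have h := D.apriori u hu.1
  have hx₀ := D.C.x₀_nonneg
  have hM₃ := D.C.hM₃
  -- `(ε + M₃‖u‖²)‖Tu‖ ≤ (ε + M₃ x₀²)‖Tu‖` since `‖u‖ ≤ x₀`
  have hsq : ‖u‖ ^ 2 ≤ D.C.x₀ ^ 2 := by
    have := hu.1
    exact pow_le_pow_left₀ (norm_nonneg _) this 2
  have h' : D.C.a * ‖D.T u‖ ^ 2 + D.C.b * D.grad (D.T u) ^ 2
      ≤ (D.C.ε + D.C.M₃ * D.C.x₀ ^ 2) * ‖D.T u‖ := by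
    calc D.C.a * ‖D.T u‖ ^ 2 + D.C.b * D.grad (D.T u) ^ 2
        ≤ (D.C.ε + D.C.M₃ * ‖u‖ ^ 2) * ‖D.T u‖ := h
      _ ≤ (D.C.ε + D.C.M₃ * D.C.x₀ ^ 2) * ‖D.T u‖ := by
          apply mul_le_mul_of_nonneg_right _ (norm_nonneg _)
          have := mul_le_mul_of_nonneg_left hsq hM₃
          linarith
  exact D.C.selfMap h'

/-- **Existence of a fixed point in `B`** (the `schauder` hypothesis applied to the kernel-checked self-map step).
[cite: Schauder1930] -/
theorem exists_fixedPoint : ∃ u : X, D.ball u ∧ D.T u = u :=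
  D.schauder (fun u hu => D.selfMap_ball u hu)

/-- **The Schauder-CAP conclusion**: the data yield a classical profile with the datum's far field in IJP26's
hypothesis class, at `a + u` with `‖u‖ ≤ x₀`. Exactly the fields of `ProfileSchauderData` and the setting's
`zero_profileHyp` are consumed. [folklore] -/
theorem profileHyp_of_schauderData :
    ∃ u : X, ‖u‖ ≤ D.C.x₀ ∧ ProfileHyp S.datum (S.velocity (D.a + u)) (S.pressure (D.a + u)) := by
  obtain ⟨u, hu, hfix⟩ := D.exists_fixedPoint
  exact ⟨u, hu.1, S.zero_profileHyp _ (D.fixed_zero u hfix)⟩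

end ProfileSchauderData

end Literature.Analysis.FluidPDE.GuillodSverak2023
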